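import Mathlib.InformationTheory.Hamming
import Mathlib.Data.Matrix.Mul
import Literature.InformationTheory.QuantumCodes.SymplecticCodes
import Literature.Computability.Complexity.BoolEncodings
import Literature.Computability.Complexity.GraphEncodings
import Literature.Computability.Complexity.Reductions
import HarnessLib

/-!
# NP-hardness of the minimum distance: binary linear codes (Vardy 1997) and quantum stabilizer / CSS codes (Kapshikar–Kundu 2023)

The decision problems behind every «coverage sentence» of a distance census, as languages over
`{0,1}` in the tree's complexity vocabulary (`Computability.Encoding.toLanguage`,
`Literature.Computability.Complexity.IsNPComplete / IsNPHard`, cf. `KarpProblems.lean`), and the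
published hardness theorems as NAMED FACTS (D-0014):

* `MINDIST` — Vardy's MINIMUM DISTANCE: "Instance: A binary `m × n` matrix `H` and an integer
  `w > 0`. Question: Is there a nonzero vector `x ∈ 𝔽₂ⁿ` of weight `≤ w`, such that `H xᵗ = 0`?"
  [Vardy1997, §I p. 1757]; `Vardy1997_minimumDistance_isNPComplete : Prop := IsNPComplete MINDIST`
  is his Theorem 5 (§IV, p. 1763: "MINIMUM DISTANCE is NP-complete").
* `QMINDIST` — the quantum minimum-distance problem for a stabilizer code given in the
  `𝔽₂` (symplectic) representation `S ∈ 𝔽₂^{r × 2n}` (rows `(a|b)`, Kapshikar–Kundu §2.2.1):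
  "is there an undetectable Pauli error `E ≠ I` of weight `≤ t`", i.e. an element of `S̄⊥ ∖ S̄`
  (symplectic dual minus the stabilizer space, the tree's `sympDual` / `sympWeight` of
  `SymplecticCodes.lean`) of weight `≤ t`; `KapshikarKundu2023_quantumMinimumDistance_isNPHard :
  Prop := IsNPHard QMINDIST` records their Theorem 2 ("QMD is NP-complete", stated for the
  codeword-stabilized (CWS) input `(H, G, t)`) transported to the stabilizer-generator input by
  their §4.1 ("our hardness results from Theorem 2 translate to the standard input of the
  stabilizer framework as well", via the polynomial CWS → stabilizer conversion [KDP11]).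
* `CSSMINDIST` — the same question for a CSS pair `(H_X, H_Z)`;
  `KapshikarKundu2023_cssMinimumDistance_isNPHard : Prop := IsNPHard CSSMINDIST` is their
  Corollary 3 ("The minimum distance problem for CSS codes is NP-hard").

Only the EXACT decision versions are typed. The approximation versions (`GQMD_γ`, `GAQMD_τ`,
NP-hard under randomised RUR reductions, Thm 2 / Cor 3 second halves) need the promise-problem /
randomised-reduction vocabulary of `Literature/Algebra/EuclideanLattices/LatticeComplexity.lean`
and are deliberately NOT stated here. NP-MEMBERSHIP of the stabilizer- and CSS-input versions is
routine but is not a printed statement, so only `IsNPHard` is recorded for them.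

Conventions. Instances whose rows do not pairwise commute (not a stabilizer code) are
no-instances (the yes-sets below include `IsSelfOrthogonal`); `k = 0` codes (where `S̄⊥ = S̄`) are
no-instances for every `t`, matching "undetectable error" (Kapshikar–Kundu use a separate
graph-state distance for `k = 0`, Def. 2 / Claim 1, which is not this language). Weight of
`(a|b)` is the number of non-identity tensor factors (`sympWeight`), not `|a| + |b|`.

## References

* A. Vardy, *The intractability of computing the minimum distance of a code*, IEEE Trans.
  Inform. Theory 43 (1997) 1757–1766 [Vardy1997]: §I problem MINIMUM DISTANCE (p. 1757),
  §IV Theorem 5 (p. 1763), §V remark (p. 1764: extends to every fixed `GF(q)`).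
* U. Kapshikar, S. Kundu, *On the hardness of the minimum distance problem of quantum codes*,
  IEEE Trans. Inform. Theory 69 (2023) 6293–6302 = arXiv:2203.04262 [KapshikarKundu2023]:
  §3 Problems 1–4, §4 Theorem 2, §4.1 (stabilizer-framework input) and Corollary 3 (CSS).
* For the vocabulary: `Literature/Computability/Complexity/{BoolEncodings,GraphEncodings,
  Reductions}.lean`, `Literature/InformationTheory/QuantumCodes/SymplecticCodes.lean`.

## Mathlib / tree search

`lean search 'MinimumDistance|MINDIST|minimumDistanceSet|QMD'` (2026-08-26): no decision-problem
language for code distance in Mathlib or the tree; the classical `Coding.minDist` (value, `ℕ∞`)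
and the quantum `HasMinDist` (predicate) exist and are what the yes-sets below unfold to.
-/

namespace Literature.InformationTheory.QuantumCodes

open _root_.Computability Literature.Computability.Complexity

/-! ### Boolean codes of `𝔽₂`-vectors and matrices -/

/-- Every element of `𝔽₂ = ZMod 2` is `0` or `1`, as the bit `a = 1` (plumbing for the decoder). [folklore] -/
private theorem zmod2_eq_ite (a : ZMod 2) : (if a = 1 then (1 : ZMod 2) else 0) = a := by
  revert a; decide

/-- Vectors `𝔽₂ⁿ` over `Bool`: the bit string `[x₀ = 1][x₁ = 1]⋯[x_{n-1} = 1]`; decoding checks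
the length. (The `ZMod 2`-valued twin of `encodingBitVec`.) [cite: Vardy1997, §I (p. 1757: "a binary m × n matrix H")] -/
def encodingF2Vec (n : ℕ) : Encoding (Fin n → ZMod 2) Bool where
  encode x := List.ofFn fun i => decide (x i = 1)
  decode w := if h : w.length = n then some (fun i => if w.get (i.cast h.symm) then 1 else 0) else none
  decode_encode x := by
    simp only [List.length_ofFn, dite_true, Option.some.injEq]
    funext i
    simp only [List.get_eq_getElem, Fin.val_cast, List.getElem_ofFn, decide_eq_true_eq]
    exact zmod2_eq_ite (x i)

/-- Binary `m × n` matrices `⟨m, n, H⟩`, row `i` being `H i : 𝔽₂ⁿ`; over `Bool` as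
`⟨code m, ⟨code n, [row₀, …, row_{m-1}]⟩⟩`. [cite: Vardy1997, §I (p. 1757)] -/
def encodingF2Matrix : Encoding (Σ m : ℕ, Σ n : ℕ, Fin m → Fin n → ZMod 2) Bool :=
  Encoding.sigmaBool fun m => Encoding.sigmaBool fun n => encodingFinVec (encodingF2Vec n) m

/-- Lists of `r` symplectic vectors `(a|b) ∈ 𝔽₂ⁿ × 𝔽₂ⁿ` (the rows of a stabilizer matrix
`S ∈ 𝔽₂^{r × 2n}`), as `⟨code r, ⟨code n, [⟨a₀,b₀⟩, …]⟩⟩`.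
[cite: KapshikarKundu2023, §2.2.1 ("An [[n,k]] stabilizer code is specified by a matrix S ∈ 𝔽₂^{(n−k)×2n}, where each row … is interpreted as a string of the form (a|b)")] -/
def encodingSympRows : Encoding (Σ r : ℕ, Σ n : ℕ, Fin r → SympVec n) Bool :=
  Encoding.sigmaBool fun r => Encoding.sigmaBool fun n =>
    encodingFinVec ((encodingF2Vec n).pairBool (encodingF2Vec n)) r

/-- CSS pairs `⟨m_X, m_Z, n, (H_X, H_Z)⟩` of binary matrices with `n` columns, over `Bool`.
[cite: KapshikarKundu2023, §4.1 (CSS codes: S_X = {X(c) : c ∈ C₁}, S_Z = {Z(c) : c ∈ C₂})] -/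
def encodingCSSPair :
    Encoding (Σ mX : ℕ, Σ mZ : ℕ, Σ n : ℕ, (Fin mX → Fin n → ZMod 2) × (Fin mZ → Fin n → ZMod 2))
      Bool :=
  Encoding.sigmaBool fun mX => Encoding.sigmaBool fun mZ => Encoding.sigmaBool fun n =>
    (encodingFinVec (encodingF2Vec n) mX).pairBool (encodingFinVec (encodingF2Vec n) mZ)

/-! ### MINIMUM DISTANCE (Vardy 1997) -/

/-- Yes-instances of MINIMUM DISTANCE: pairs `(⟨m, n, H⟩, w)` such that some NONZERO `x ∈ 𝔽₂ⁿ`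
of Hamming weight `≤ w` satisfies `H x = 0`. (Vardy asks `w > 0`; for `w = 0` there is no such
`x`, so admitting `w = 0` adds only no-instances.)
[cite: Vardy1997, §I (p. 1757, problem MINIMUM DISTANCE)] -/
def minimumDistanceSet : Set ((Σ m : ℕ, Σ n : ℕ, Fin m → Fin n → ZMod 2) × ℕ) :=
  {p | ∃ x : Fin p.1.2.1 → ZMod 2, x ≠ 0 ∧ hammingNorm x ≤ p.2 ∧ (Matrix.of p.1.2.2).mulVec x = 0}

/-- Unfolding lemma for `minimumDistanceSet`: Vardy's question verbatim.
[cite: Vardy1997, §I (p. 1757, problem MINIMUM DISTANCE)] -/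
theorem mem_minimumDistanceSet_iff (p : (Σ m : ℕ, Σ n : ℕ, Fin m → Fin n → ZMod 2) × ℕ) :
    p ∈ minimumDistanceSet ↔
      ∃ x : Fin p.1.2.1 → ZMod 2, x ≠ 0 ∧ hammingNorm x ≤ p.2 ∧ (Matrix.of p.1.2.2).mulVec x = 0 :=
  Iff.rfl

/-- The yes-set is monotone in the weight bound `w` (so the least yes-`w` is the minimum distance,
Vardy's "successively running an algorithm for [MINIMUM DISTANCE] with `w = 1, 2, …`").
[cite: Vardy1997, §I (p. 1757)] -/
theorem minimumDistanceSet_mono {H : Σ m : ℕ, Σ n : ℕ, Fin m → Fin n → ZMod 2} {w w' : ℕ}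
    (hw : w ≤ w') (h : (H, w) ∈ minimumDistanceSet) : (H, w') ∈ minimumDistanceSet := by
  obtain ⟨x, hx0, hxw, hHx⟩ := h
  exact ⟨x, hx0, hxw.trans hw, hHx⟩

/-- The language MINIMUM DISTANCE over `{0,1}`: codes `⟨code ⟨m,n,H⟩, code w⟩` of the members of
`minimumDistanceSet`. [cite: Vardy1997, §I (p. 1757)] -/
def MINDIST : Language Bool :=
  (encodingF2Matrix.pairBool encodingNatBool).toLanguage minimumDistanceSet

/-- **Vardy 1997, Theorem 5: MINIMUM DISTANCE is NP-complete** ("Theorem 5: MINIMUM DISTANCE is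
NP-complete", §IV p. 1763; the problem is stated in §I p. 1757; by §V p. 1764 the proof extends to
linear codes over every fixed finite field). Consequently computing the minimum distance of a
binary linear code is NP-hard, which is why every distance census states its coverage. Named fact
(D-0014); the tree's `IsNPComplete` is Karp-completeness for `NP = polyExists P`.
[cite: Vardy1997, §IV Theorem 5 (p. 1763)] -/
def Vardy1997_minimumDistance_isNPComplete : Prop :=
  IsNPComplete MINDIST

/-! ### Quantum minimum distance, stabilizer-generator input (Kapshikar–Kundu 2023) -/

variable {n : ℕ}

/-- The stabilizer space `S̄ ≤ 𝔽₂ⁿ × 𝔽₂ⁿ` spanned by the rows `(a|b)` of a stabilizer matrix.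
[cite: KapshikarKundu2023, §2.2.1] -/
def rowSpan {r : ℕ} (rows : Fin r → SympVec n) : Submodule (ZMod 2) (SympVec n) :=
  Submodule.span (ZMod 2) (Set.range rows)

/-- Each generator row lies in the stabilizer space it spans. [cite: KapshikarKundu2023, §2.2.1] -/
theorem row_mem_rowSpan {r : ℕ} (rows : Fin r → SympVec n) (i : Fin r) : rows i ∈ rowSpan rows :=
  Submodule.subset_span ⟨i, rfl⟩

/-- Yes-instances of the quantum minimum-distance problem with stabilizer-generator input:
`(⟨r, n, S⟩, t)` such that the rows of `S` pairwise commute (`S̄` self-orthogonal for the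
symplectic form — otherwise `S` presents no stabilizer code) and there is an UNDETECTABLE error of
weight `≤ t`: an element of `S̄⊥ ∖ S̄` of symplectic weight `≤ t` (equivalently
`¬ HasMinDist S̄ (t+1)`). [cite: KapshikarKundu2023, §3 Problem 4 (QMD) with §2.2.1–§4.1 (symplectic input)] -/
def quantumMinimumDistanceSet : Set ((Σ r : ℕ, Σ n : ℕ, Fin r → SympVec n) × ℕ) :=
  {p | IsSelfOrthogonal (rowSpan p.1.2.2) ∧
    ∃ w ∈ sympDual (rowSpan p.1.2.2), w ∉ rowSpan p.1.2.2 ∧ sympWeight w ≤ p.2}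

/-- The distance clause of `quantumMinimumDistanceSet` is the negation of the tree's
`HasMinDist S̄ (t + 1)` ("no vectors of weight `≤ t` in `S̄⊥ ∖ S̄`", CRSS Thm. 1): a
yes-instance is exactly a stabilizer matrix whose code does NOT have minimum distance `≥ t + 1`.
[cite: CalderbankEtAl1998, §2 Thm. 1 (printed p. 4)] -/
theorem exists_undetectable_iff_not_hasMinDist (S : Submodule (ZMod 2) (SympVec n)) (t : ℕ) :
    (∃ w ∈ sympDual S, w ∉ S ∧ sympWeight w ≤ t) ↔ ¬ HasMinDist S (t + 1) := by
  unfold HasMinDist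
  push Not
  constructor
  · rintro ⟨w, hw, hwS, hwt⟩
    exact ⟨w, hw, hwS, Nat.lt_succ_of_le hwt⟩
  · rintro ⟨w, hw, hwS, hwt⟩
    exact ⟨w, hw, hwS, Nat.le_of_lt_succ hwt⟩

/-- The language QMD (stabilizer-generator input) over `{0,1}`. [cite: KapshikarKundu2023, §3 Problem 4, §4.1] -/
def QMINDIST : Language Bool :=
  (encodingSympRows.pairBool encodingNatBool).toLanguage quantumMinimumDistanceSet

/-- **Kapshikar–Kundu 2023: the minimum-distance problem for stabilizer codes is NP-hard.**
Theorem 2 (§4): "QMD is NP-complete. For every γ ≥ 1, GQMD_γ is NP-hard under polynomial time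
RUR reductions …; there exists τ > 0 such that GAQMD_τ is NP-hard …; versions … where the code is
promised to be non-degenerate are also NP-hard" — proved for the codeword-stabilized input
`(H, G, t)` by a reduction from Vardy's MINIMUM DISTANCE (`Vardy1997_minimumDistance_isNPComplete`)
with `qdist(Q) = dist(C(H))`; §4.1: "the CWS description of a code can be efficiently converted to
its stabilizer description [KDP11]. Therefore, our hardness results from Theorem 2 translate to the
standard input of the stabilizer framework as well." Recorded here for that standard input
(`QMINDIST`) and for the exact problem only; NP-hardness, not completeness, is what is printed for
this input. Named fact (D-0014).
[cite: KapshikarKundu2023, §4 Theorem 2 and §4.1] -/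
def KapshikarKundu2023_quantumMinimumDistance_isNPHard : Prop :=
  IsNPHard QMINDIST

/-! ### Quantum minimum distance, CSS input (Kapshikar–Kundu 2023, Corollary 3) -/

/-- The stabilizer space of the CSS code with X-checks the rows of `H_X` and Z-checks the rows of
`H_Z`: spanned by the `(H_X i | 0)` and the `(0 | H_Z j)` in `𝔽₂ⁿ × 𝔽₂ⁿ`.
[cite: KapshikarKundu2023, §4.1 (S_X = {X(c)}, S_Z = {Z(c)})] -/
def cssRowSpan {mX mZ : ℕ} (HX : Fin mX → Fin n → ZMod 2) (HZ : Fin mZ → Fin n → ZMod 2) :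
    Submodule (ZMod 2) (SympVec n) :=
  Submodule.span (ZMod 2) (Set.range (fun i => ((HX i, 0) : SympVec n)) ∪
    Set.range (fun j => ((0, HZ j) : SympVec n)))

/-- X-check rows lie in the CSS stabilizer space (`X(c)`, `c` a row of `H_X`). [cite: KapshikarKundu2023, §4.1] -/
theorem xRow_mem_cssRowSpan {mX mZ : ℕ} (HX : Fin mX → Fin n → ZMod 2)
    (HZ : Fin mZ → Fin n → ZMod 2) (i : Fin mX) : ((HX i, 0) : SympVec n) ∈ cssRowSpan HX HZ :=
  Submodule.subset_span (Or.inl ⟨i, rfl⟩)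

/-- Z-check rows lie in the CSS stabilizer space (`Z(c)`, `c` a row of `H_Z`). [cite: KapshikarKundu2023, §4.1] -/
theorem zRow_mem_cssRowSpan {mX mZ : ℕ} (HX : Fin mX → Fin n → ZMod 2)
    (HZ : Fin mZ → Fin n → ZMod 2) (j : Fin mZ) : ((0, HZ j) : SympVec n) ∈ cssRowSpan HX HZ :=
  Submodule.subset_span (Or.inr ⟨j, rfl⟩)

/-- Yes-instances of the CSS minimum-distance problem: `(⟨m_X, m_Z, n, (H_X, H_Z)⟩, t)` such that
the X- and Z-checks commute (self-orthogonality of the CSS stabilizer space, i.e. `H_X H_Zᵗ = 0`)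
and some undetectable error (element of `S̄⊥ ∖ S̄`) has weight `≤ t`, i.e. `min(d_X, d_Z) ≤ t`.
[cite: KapshikarKundu2023, §4.1 Corollary 3] -/
def cssMinimumDistanceSet :
    Set ((Σ mX : ℕ, Σ mZ : ℕ, Σ n : ℕ,
      (Fin mX → Fin n → ZMod 2) × (Fin mZ → Fin n → ZMod 2)) × ℕ) :=
  {p | IsSelfOrthogonal (cssRowSpan p.1.2.2.2.1 p.1.2.2.2.2) ∧
    ∃ w ∈ sympDual (cssRowSpan p.1.2.2.2.1 p.1.2.2.2.2),
      w ∉ cssRowSpan p.1.2.2.2.1 p.1.2.2.2.2 ∧ sympWeight w ≤ p.2}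

/-- The language CSS-QMD over `{0,1}`. [cite: KapshikarKundu2023, §4.1 Corollary 3] -/
def CSSMINDIST : Language Bool :=
  (encodingCSSPair.pairBool encodingNatBool).toLanguage cssMinimumDistanceSet

/-- **Kapshikar–Kundu 2023, Corollary 3: the minimum-distance problem for CSS codes is NP-hard**
("The minimum distance problem for CSS codes is NP-hard. Multiplicatively or additively
approximating the distance of a CSS code is also NP-hard under polynomial-time randomized
reductions."), obtained from Theorem 2 through the Bravyi–Terhal–Leemhuis stabilizer → Majorana →
CSS mapping (§4.1). Only the first (exact) sentence is typed. Named fact (D-0014).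
[cite: KapshikarKundu2023, §4.1 Corollary 3] -/
def KapshikarKundu2023_cssMinimumDistance_isNPHard : Prop :=
  IsNPHard CSSMINDIST

end Literature.InformationTheory.QuantumCodes
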